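import Mathlib
import HarnessLib
import Summits.QuantumFields.YangMills.Theses.PencilRigidity
import Summits.QuantumFields.YangMills.Theorems.PencilRigidityCurvatureKernelBoundLatticeWindowTransfer
import Summits.QuantumFields.YangMills.Theorems.PencilRigidityCurvatureKernelBoundTwoPointLocalBoundSemiDegenerate

/-!
# `CurvatureKernelBound` — stub B₁ `TwoPointLocalBoundScaling` (support for stmt-QuantumFields-11687, line `sixteen-charts-analytic-kernel`, skeleton v11)

`W₁` + the pair lattice window bound ⇒ local `L¹⊗L¹ + r⁸ L^∞⊗L^∞` bounds on `S₁ 2` near the time axis with constants `≲ s⁻¹⁰` (as in L3 `LatticeWindowTransfer`: lattice tie at n = 2, 1; `S₁ 1 = κ∫`; `abs_truncated_le_of_cov_le`; crude lattice point count for functions supported in a ball).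
-/

noncomputable section

open scoped BigOperators Topology SchwartzMap ComplexConjugate InnerProductSpace
open MeasureTheory Filter Set Metric
open Literature.MathematicalPhysics.QuantumLattice Literature.MathematicalPhysics.AQFT
open Literature.MathematicalPhysics.QuantumFieldTheory

open Literature.Probability.LatticeModels (box)

namespace Summit.QuantumFields.YangMills.Theorems.CurvatureKernel

namespace TwoPointLocal

/-! ## Elementary lemmas for the scaling branch of the local two-point bound -/

/-- The distance of the two centres `∓s e₀` is `2s` (`0 < s`). [folklore] -/
theorem dist_single_neg_single {s : ℝ} (hs : 0 < s) :
    dist (EuclideanSpace.single (0 : Fin 4) (-s) : EuclideanSpace ℝ (Fin 4))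
      (EuclideanSpace.single (0 : Fin 4) s) = 2 * s := by
  rw [PiLp.dist_single_same, Real.dist_eq, show -s - s = -(2 * s) by ring, abs_neg,
    abs_of_pos (by positivity)]

/-- **Geometry of a contributing pair.** If `u ∈ B̄(−s e₀, ρ)`, `v ∈ B̄(s e₀, ρ)` and `ρ ≤ s/2`, then
`s ≤ ‖u − v‖ ≤ 3s` (the pattern of `LatticeWindow.norm_sub_mem_window` for two balls). [folklore] -/
theorem norm_sub_mem_window_of_balls {s ρ : ℝ} (hs : 0 < s) (hρ : ρ ≤ s / 2)
    {u v : EuclideanSpace ℝ (Fin 4)}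
    (hu : u ∈ Metric.closedBall (EuclideanSpace.single (0 : Fin 4) (-s) : EuclideanSpace ℝ (Fin 4)) ρ)
    (hv : v ∈ Metric.closedBall (EuclideanSpace.single (0 : Fin 4) s : EuclideanSpace ℝ (Fin 4)) ρ) :
    s ≤ ‖u - v‖ ∧ ‖u - v‖ ≤ 3 * s := by
  rw [Metric.mem_closedBall, dist_eq_norm] at hu hv
  have hc : ‖(EuclideanSpace.single (0 : Fin 4) (-s) : EuclideanSpace ℝ (Fin 4)) -
      EuclideanSpace.single (0 : Fin 4) s‖ = 2 * s := by
    rw [← dist_eq_norm, dist_single_neg_single hs]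
  have hd : ‖(u - v) - ((EuclideanSpace.single (0 : Fin 4) (-s) : EuclideanSpace ℝ (Fin 4)) -
      EuclideanSpace.single (0 : Fin 4) s)‖ ≤ 2 * ρ := by
    calc ‖(u - v) - ((EuclideanSpace.single (0 : Fin 4) (-s) : EuclideanSpace ℝ (Fin 4)) -
          EuclideanSpace.single (0 : Fin 4) s)‖
        = ‖(u - EuclideanSpace.single (0 : Fin 4) (-s)) - (v - EuclideanSpace.single (0 : Fin 4) s)‖ := by
          congr 1; abel
      _ ≤ ‖u - EuclideanSpace.single (0 : Fin 4) (-s)‖ + ‖v - EuclideanSpace.single (0 : Fin 4) s‖ :=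
          norm_sub_le _ _
      _ ≤ 2 * ρ := by linarith
  have h := abs_norm_sub_norm_le (u - v)
    ((EuclideanSpace.single (0 : Fin 4) (-s) : EuclideanSpace ℝ (Fin 4)) - EuclideanSpace.single (0 : Fin 4) s)
  rw [hc] at h
  obtain ⟨h1, h2⟩ := abs_le.1 (h.trans hd)
  constructor <;> linarith

/-- `(2s)^(η−10) ≤ 2^(η−10) · s⁻¹ ^ 10` for `0 < s ≤ 1`, `0 < η`. [folklore] -/
theorem two_mul_rpow_sub_ten_le {η s : ℝ} (hη : 0 < η) (hs : 0 < s) (hs1 : s ≤ 1) :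
    (2 * s) ^ (η - 10) ≤ 2 ^ (η - 10) * s⁻¹ ^ (10 : ℕ) := by
  rw [Real.mul_rpow zero_le_two hs.le]
  refine mul_le_mul_of_nonneg_left ?_ (Real.rpow_nonneg zero_le_two _)
  calc s ^ (η - 10) ≤ s ^ (-(10 : ℝ)) := Real.rpow_le_rpow_of_exponent_ge hs hs1 (by linarith)
    _ = s⁻¹ ^ (10 : ℕ) := by rw [Real.rpow_neg hs.le, ← Real.inv_rpow hs.le, Real.rpow_ofNat]

/-- **Assembly of the two estimates.** From `‖S − P‖ ≤ Z` (lattice side) and `‖P‖ ≤ W` (disconnected part):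
`‖S‖ ≤ W + Z`. [folklore] -/
theorem norm_le_of_norm_sub_le {S P : ℂ} {Z W : ℝ} (hZ : ‖S - P‖ ≤ Z) (hP : ‖P‖ ≤ W) : ‖S‖ ≤ W + Z := by
  linarith [norm_sub_norm_le S P]

end TwoPointLocal

open TwoPointLocal SemiDegenerate LatticeWindow BoundedRenormalisation in
/-- **Stub `TwoPointLocalBoundScaling`** (registered signature verbatim). See the module docstring. [folklore] -/
theorem TwoPointLocalBoundScaling : open Literature.MathematicalPhysics.QuantumLattice Literature.MathematicalPhysics.AQFT Literature.MathematicalPhysics.QuantumFieldTheory in ∀ (G : Type) [Group G] [TopologicalSpace G] [IsTopologicalGroup G] [CompactSpace G] [MeasurableSpace G] [BorelSpace G], IsCompactSimpleLieGroup G → ∀ (r : LatticeRep G) (sch : SpeciesScheme (YMSpecies G)) (S₁ : SchwingerFamily (EuclideanSpace ℝ (Fin 4))), ((∀ (n : ℕ), n ≠ 0 → ∀ (f : Fin n → SchwartzMap (EuclideanSpace ℝ (Fin 4)) ℝ) (F : SchwartzMap (Fin n → (EuclideanSpace ℝ (Fin 4))) ℂ), IsTensorOf F (fun i => ofRealTest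 (f i)) → IsOffDiagonal F → Filter.Tendsto (fun k : ℕ => ((latticeSchwinger r.ρ sch (fun s => s.F) k n (fun _ => r.curvature) f : ℝ) : ℂ)) Filter.atTop (nhds (S₁ n F))) ∧ (S₁.toLabelled.IsNormalized ∧ S₁.toLabelled.IsHermitian ∧ S₁.toLabelled.HasLinearGrowth ∧ S₁.toLabelled.IsReflectionPositive ∧ S₁.toLabelled.IsSymmetric ∧ S₁.toLabelled.HasClusterProperty) ∧ (∀ (n : ℕ) (a : (EuclideanSpace ℝ (Fin 4))) (F : SchwartzMap (Fin n → (EuclideanSpace ℝ (Fin 4))) ℂ), IsOffDiagonal F → S₁ n (translateMulti a F) = S₁ n F) ∧ (∀ (R : (EuclideanSpace ℝ (Fin 4)) ≃ₗᵢ[ℝ] (EuclideanSpace ℝ (Fin 4))), LinearMap.det (R.toLinearEquiv : (EuclideanSpace ℝ (Fin 4)) →ₗ[ℝ] (EuclideanSpace ℝ (Fin 4))) = 1 → (∀ i : Fin 4, ∃ j : Fin 4, R (EuclideanSpace.single i 1) = EuclideanSpace.single j 1 ∨ R (EuclideanSpace.single i 1) = -EuclideanSpace.single j 1) → ∀ (n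 : ℕ) (F : SchwartzMap (Fin n → (EuclideanSpace ℝ (Fin 4))) ℂ), IsOffDiagonal F → S₁ n (linActMulti R F) = S₁ n F) ∧ (∃ Δ : ℝ, 0 < Δ ∧ S₁.toLabelled.HasMassGap Δ ∧ HasLatticeMassGap r sch Δ)) → (∃ (C η θ R₀ : ℝ), 0 < η ∧ 0 < θ ∧ ∃ᶠ k in Filter.atTop, ∀ x y : Literature.Probability.LatticeModels.Site 4, x ∈ Literature.Probability.LatticeModels.box 4 (sch.L k) → y ∈ Literature.Probability.LatticeModels.box 4 (sch.L k) → R₀ ≤ ‖siteToE x - siteToE y‖ → sch.a k * ‖siteToE x - siteToE y‖ ≤ θ → (sch.c r.curvature k) ^ 2 * |(∫ U, r.curvature.F (configShift (-x) (torusLift (sch.side k) U)) * r.curvature.F (configShift (-y) (torusLift (sch.side k) U)) ∂(wilsonMeasure r.ρ (sch.β k) : MeasureTheory.Measure (GaugeConfig 4 (sch.side k) G))) - (∫ U, r.curvature.F (configShift (-x) (torusLift (sch.side k) U)) ∂(wilsonMeasure r.ρ (sch.β k) : MeasureTheory.Measure (GaugeConfig 4 (sch.side k) G))) * (∫ U,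 r.curvature.F (configShift (-y) (torusLift (sch.side k) U)) ∂(wilsonMeasure r.ρ (sch.β k) : MeasureTheory.Measure (GaugeConfig 4 (sch.side k) G)))| ≤ C * (sch.a k * ‖siteToE x - siteToE y‖) ^ (η - 10)) → ∃ (s₁ A₀ : ℝ) (p₀ : ℕ), 0 < s₁ ∧ 0 ≤ A₀ ∧ (∀ (s : ℝ), 0 < s → s < s₁ → ∃ (r₀ A B : ℝ), 0 < r₀ ∧ 0 ≤ A ∧ 0 ≤ B ∧ A + B ≤ A₀ * (1 + s⁻¹ ^ p₀) ∧ (∀ (r : ℝ), 0 < r → r ≤ r₀ → ∀ (f : Fin 2 → SchwartzMap (EuclideanSpace ℝ (Fin 4)) ℝ) (F : SchwartzMap (Fin 2 → (EuclideanSpace ℝ (Fin 4))) ℂ) (M₀ M₁ : ℝ), IsTensorOf F (fun i => ofRealTest (f i)) → tsupport ((f 0 : SchwartzMap (EuclideanSpace ℝ (Fin 4)) ℝ) : (EuclideanSpace ℝ (Fin 4)) → ℝ) ⊆ Metric.closedBall (EuclideanSpace.single (0 : Fin 4) (-s)) r → tsupport ((f 1 : SchwartzMap (EuclideanSpace ℝ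 (Fin 4)) ℝ) : (EuclideanSpace ℝ (Fin 4)) → ℝ) ⊆ Metric.closedBall (EuclideanSpace.single (0 : Fin 4) s) r → (∀ x, |f 0 x| ≤ M₀) → (∀ x, |f 1 x| ≤ M₁) → ‖S₁ 2 F‖ ≤ A * (∫ x : (EuclideanSpace ℝ (Fin 4)), |f 0 x|) * (∫ x : (EuclideanSpace ℝ (Fin 4)), |f 1 x|) + B * r ^ 8 * M₀ * M₁)) := by
  intro G _ _ _ _ _ _ _ r sch S₁ hW₁ hwin
  obtain ⟨htie, -, htr, -, -⟩ := hW₁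
  obtain ⟨C, η, θ, R₀, hη, hθ, hfreq⟩ := hwin
  obtain ⟨κ, hκ⟩ := exists_degreeOne_eq_const_mul_realIntegral S₁ htr
  -- a subsequence along which the window bound holds
  obtain ⟨φ, hφmono, hφW⟩ := Filter.extraction_of_frequently_atTop hfreq
  have hφa : Tendsto (fun j => sch.a (φ j)) atTop (𝓝 0) := sch.tendsto_a.comp hφmono.tendsto_atTop
  -- constants
  obtain ⟨Cp, hCCp, hCpnn⟩ : ∃ Cp : ℝ, C ≤ Cp ∧ 0 ≤ Cp := ⟨max C 0, le_max_left _ _, le_max_right _ _⟩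
  obtain ⟨Q, hQ, hQnn⟩ : ∃ Q : ℝ, Q = Cp * ((3 / 2) ^ η * 2 ^ (10 : ℝ)) ∧ 0 ≤ Q :=
    ⟨_, rfl, by positivity⟩
  refine ⟨min 1 (θ / 3), ‖κ‖ ^ 2 + 3 ^ 8 * Q * 2 ^ (η - 10), 10, lt_min one_pos (by positivity),
    by positivity, ?_⟩
  intro s hs hs₁
  have hs1 : s ≤ 1 := hs₁.le.trans (min_le_left _ _)
  have hsθ : 3 * s ≤ θ := by
    have := hs₁.le.trans (min_le_right _ _)
    linarith
  -- the per-pair constant on the window `[s, 3s]`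
  obtain ⟨D, hDdef, hDnn⟩ : ∃ D : ℝ, D = Q * (2 * s) ^ (η - 10) ∧ 0 ≤ D := ⟨_, rfl, by positivity⟩
  refine ⟨s / 2, ‖κ‖ ^ 2, 3 ^ 8 * D, half_pos hs, by positivity, by positivity, ?_, ?_⟩
  · -- `A + B ≤ A₀ (1 + s⁻¹ ^ 10)`
    have hpow := two_mul_rpow_sub_ten_le hη hs hs1
    have hX : (0 : ℝ) ≤ s⁻¹ ^ (10 : ℕ) := by positivity
    have h3Q : (0 : ℝ) ≤ 3 ^ 8 * Q * 2 ^ (η - 10) := by positivity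
    have hB : 3 ^ 8 * D ≤ 3 ^ 8 * Q * 2 ^ (η - 10) * s⁻¹ ^ (10 : ℕ) := by
      have h1 : D ≤ Q * (2 ^ (η - 10) * s⁻¹ ^ (10 : ℕ)) := by
        rw [hDdef]
        exact mul_le_mul_of_nonneg_left hpow hQnn
      calc 3 ^ 8 * D ≤ 3 ^ 8 * (Q * (2 ^ (η - 10) * s⁻¹ ^ (10 : ℕ))) := by gcongr
        _ = 3 ^ 8 * Q * 2 ^ (η - 10) * s⁻¹ ^ (10 : ℕ) := by ring
    nlinarith [mul_nonneg (sq_nonneg ‖κ‖) hX, hB, h3Q]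
  · intro ρ hρ hρs f F M₀ M₁ hFt hsupp₀ hsupp₁ hM₀ hM₁
    have hM₀nn : 0 ≤ M₀ := (abs_nonneg _).trans (hM₀ 0)
    have hM₁nn : 0 ≤ M₁ := (abs_nonneg _).trans (hM₁ 0)
    -- the two closed balls are disjoint, so `F` is off-diagonal
    have hdisj : Disjoint (tsupport ((f 0 : 𝓢(EuclideanSpace ℝ (Fin 4), ℝ)) : EuclideanSpace ℝ (Fin 4) → ℝ))
        (tsupport ((f 1 : 𝓢(EuclideanSpace ℝ (Fin 4), ℝ)) : EuclideanSpace ℝ (Fin 4) → ℝ)) :=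
      Disjoint.mono hsupp₀ hsupp₁ (disjoint_closedBall_single hs hρs)
    have hFoff : IsOffDiagonal F := isOffDiagonal_of_isTensorOf_of_disjoint hFt hdisj
    obtain ⟨F₀, hF₀⟩ := exists_isTensorOf (n := 1) (fun _ : Fin 1 => ofRealTest (f 0))
    obtain ⟨F₁, hF₁⟩ := exists_isTensorOf (n := 1) (fun _ : Fin 1 => ofRealTest (f 1))
    -- (1) lattice side: the per-pair covariance bound along the good subsequence
    have hsmallmesh : ∀ᶠ j in atTop, sch.a (φ j) < ρ ∧ sch.a (φ j) * R₀ < s := by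
      refine (hφa.eventually (gt_mem_nhds hρ)).and ?_
      have ht : Tendsto (fun j => sch.a (φ j) * R₀) atTop (𝓝 (0 * R₀)) := hφa.mul_const R₀
      rw [zero_mul] at ht
      exact ht.eventually (gt_mem_nhds hs)
    have hlat : ∀ᶠ j in atTop,
        ‖((latticeSchwinger r.ρ sch (fun s => s.F) (φ j) 2 (fun _ => r.curvature) f : ℝ) : ℂ) -
          ((latticeSchwinger r.ρ sch (fun s => s.F) (φ j) 1 (fun _ => r.curvature) (fun _ => f 0) : ℝ) : ℂ) *
          ((latticeSchwinger r.ρ sch (fun s => s.F) (φ j) 1 (fun _ => r.curvature) (fun _ => f 1) : ℝ) : ℂ)‖ ≤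
        D * ((3 * ρ) ^ 4 * M₀) * ((3 * ρ) ^ 4 * M₁) := by
      filter_upwards [hsmallmesh] with j hj
      obtain ⟨hjρ, hjR⟩ := hj
      set k := φ j with hk
      have hak : 0 < sch.a k := sch.a_pos k
      -- the per-pair bound for contributing pairs
      have hpair : ∀ x ∈ box 4 (sch.L k), ∀ y ∈ box 4 (sch.L k),
          f 0 (sch.a k • siteToE x) ≠ 0 → f 1 (sch.a k • siteToE y) ≠ 0 →
            (sch.c r.curvature k) ^ 2 *
              |(∫ U, r.curvature.F (configShift (-x) (torusLift (sch.side k) U)) *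
                  r.curvature.F (configShift (-y) (torusLift (sch.side k) U))
                  ∂(wilsonMeasure r.ρ (sch.β k) : MeasureTheory.Measure (GaugeConfig 4 (sch.side k) G))) -
                (∫ U, r.curvature.F (configShift (-x) (torusLift (sch.side k) U))
                  ∂(wilsonMeasure r.ρ (sch.β k) : MeasureTheory.Measure (GaugeConfig 4 (sch.side k) G))) *
                (∫ U, r.curvature.F (configShift (-y) (torusLift (sch.side k) U))
                  ∂(wilsonMeasure r.ρ (sch.β k) : MeasureTheory.Measure (GaugeConfig 4 (sch.side k) G)))| ≤ D := by
        intro x hx y hy h0 h1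
        have hu : sch.a k • siteToE x ∈
            Metric.closedBall (EuclideanSpace.single (0 : Fin 4) (-s) : EuclideanSpace ℝ (Fin 4)) ρ :=
          hsupp₀ (subset_tsupport _ h0)
        have hv : sch.a k • siteToE y ∈
            Metric.closedBall (EuclideanSpace.single (0 : Fin 4) s : EuclideanSpace ℝ (Fin 4)) ρ :=
          hsupp₁ (subset_tsupport _ h1)
        obtain ⟨hw1, hw2⟩ := norm_sub_mem_window_of_balls hs hρs hu hv
        rw [← smul_sub, norm_smul, Real.norm_of_nonneg hak.le] at hw1 hw2
        -- the pair lies in the window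
        have hR : R₀ ≤ ‖siteToE x - siteToE y‖ := by
          by_contra hlt
          have hlt' : ‖siteToE x - siteToE y‖ < R₀ := lt_of_not_ge hlt
          have : sch.a k * ‖siteToE x - siteToE y‖ ≤ sch.a k * R₀ :=
            mul_le_mul_of_nonneg_left hlt'.le hak.le
          linarith
        have hθ' : sch.a k * ‖siteToE x - siteToE y‖ ≤ θ := by linarith
        have hwin := hφW j x y hx hy hR hθ'
        rw [← hk] at hwin
        refine hwin.trans ?_
        have htpos : 0 < sch.a k * ‖siteToE x - siteToE y‖ := by linarith
        have hpow := rpow_window_le hη (by positivity : 0 < 2 * s)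
          (by linarith : 2 * s / 2 ≤ sch.a k * ‖siteToE x - siteToE y‖)
          (by linarith : sch.a k * ‖siteToE x - siteToE y‖ ≤ 3 * (2 * s) / 2)
        calc C * (sch.a k * ‖siteToE x - siteToE y‖) ^ (η - 10)
            ≤ Cp * (sch.a k * ‖siteToE x - siteToE y‖) ^ (η - 10) :=
              mul_le_mul_of_nonneg_right hCCp (Real.rpow_nonneg htpos.le _)
          _ ≤ Cp * ((3 / 2) ^ η * 2 ^ (10 : ℝ) * (2 * s) ^ (η - 10)) := mul_le_mul_of_nonneg_left hpow hCpnn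
          _ = D := by rw [hDdef, hQ]; ring
      have hL := abs_truncated_le_of_cov_le r sch r.curvature k f hpair
      have hR₀ := latticeSum_le_of_tsupport_subset_closedBall' hsupp₀ hM₀ hak hjρ.le (sch.L k)
      have hR₁ := latticeSum_le_of_tsupport_subset_closedBall' hsupp₁ hM₁ hak hjρ.le (sch.L k)
      rw [← Complex.ofReal_mul, ← Complex.ofReal_sub, Complex.norm_real, Real.norm_eq_abs]
      refine hL.trans ?_
      exact mul_le_mul (mul_le_mul_of_nonneg_left hR₀ hDnn) hR₁ (by positivity) (by positivity)
    -- the lattice tie along the subsequence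
    have hu := (htie 2 two_ne_zero f F hFt hFoff).comp hφmono.tendsto_atTop
    have hv := (htie 1 one_ne_zero (fun _ => f 0) F₀ hF₀
      (HypercubicLimit.Negative.isOffDiagonal_fin_one F₀)).comp hφmono.tendsto_atTop
    have hw := (htie 1 one_ne_zero (fun _ => f 1) F₁ hF₁
      (HypercubicLimit.Negative.isOffDiagonal_fin_one F₁)).comp hφmono.tendsto_atTop
    have hZ : ‖S₁ 2 F - S₁ 1 F₀ * S₁ 1 F₁‖ ≤ D * ((3 * ρ) ^ 4 * M₀) * ((3 * ρ) ^ 4 * M₁) :=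
      le_of_tendsto (hu.sub (hv.mul hw)).norm hlat
    -- (2) the disconnected part is `κ² (∫ f₀)(∫ f₁)`, bounded by `‖κ‖² (∫|f₀|)(∫|f₁|)`
    have hS1F₀ : S₁ 1 F₀ = κ * ((∫ y, f 0 y : ℝ) : ℂ) := hκ (f 0) F₀ hF₀
    have hS1F₁ : S₁ 1 F₁ = κ * ((∫ y, f 1 y : ℝ) : ℂ) := hκ (f 1) F₁ hF₁
    rw [hS1F₀, hS1F₁] at hZ
    have hP := norm_disconnected_le κ f
    -- (3) assembly
    have hfin := norm_le_of_norm_sub_le hZ hP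
    have hring : D * ((3 * ρ) ^ 4 * M₀) * ((3 * ρ) ^ 4 * M₁) = 3 ^ 8 * D * ρ ^ 8 * M₀ * M₁ := by ring
    linarith

end Summit.QuantumFields.YangMills.Theorems.CurvatureKernel

end
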